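import Mathlib
import Literature.Combinatorics.Enumerative.InvolutionsAvoiding321
import Literature.Combinatorics.Enumerative.InvolutionsAvoiding132Signs
import Literature.Combinatorics.Enumerative.InvolutionsAvoiding123Signs
import HarnessLib

/-!
# Even and odd `321`-avoiding involutions: `EI_n(321) − OI_n(321)` (Simion–Schmidt 1985, Proposition 5, signed half)

Layer `Literature/Combinatorics/Enumerative`, namespace `Literature.Combinatorics.Enumerative.PermContainsPattern`; lane
`lit-hodgefound` (prover seat p13, generation 39).  Sequel of `InvolutionsAvoiding321.lean` (the count
`I_n(321) = binom(n, [n/2])` by the decomposition `(τ ⊕ 1) ⊕ μ` at the last fixed point) and companion of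
`InvolutionsAvoiding132Signs.lean` (the same signed statement for `p = 132, 213`).

## Source

R. Simion, F. W. Schmidt, *Restricted permutations*, European J. Combin. **6** (1985) 383–406 [SimionSchmidt1985],
Proposition 5 (held text `paper-doi-10-1016-s0195-6698-85-80052-4`, p0007–p0008 = pp. 389–390): for each
`p ∈ {132, 321, 213}` the involutions of `S_n(p)` number `binom(n, [n/2])`, and the EVEN ones among them `EI_n(p)`
number `½ binom(n, [n/2])` for `n` even, `binom(n−1, (n−1)/2)` for `n ≡ 1 (mod 4)`, `binom(n−1, (n+1)/2)` for
`n ≡ 3 (mod 4)`; for `p = 321` the printed proof reads the sign off the shape of the Robinson–Schensted tableau («if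
`P_u` has shape `(n − b, b)` … then `sign(u) = (−1)^b`»).

## Proof formalised (no Young tableaux)

Write `δ_n = EI_n(321) − OI_n(321) = Σ_{u ∈ I_n(321)} sign u`.  The decomposition of `InvolutionsAvoiding321.lean` is
sign-multiplicative, `sign((τ ⊕ 1) ⊕ μ) = sign τ · sign μ` (§1), and a fixed-point-free involution of `[b]` has sign
`(−1)^{b/2}`; so the last-fixed-point recurrence holds with signs (§2):
`δ_N = (−1)^{N/2} J_N + Σ_{a<N} δ_a · (−1)^{(N−1−a)/2} J_{N−1−a}` (`J_{2k} = C_k`, `J_{odd} = 0`).  By strong induction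
(§3) `δ_0 = 1`, `δ_{2m+1} = (−1)^m C_m` (only the term `a = 0` survives) and `δ_{2m+2} = (−1)^{m+1} C_{m+1} +
(−1)^m Σ_{i+j=m} C_i C_j = 0` (Segner) — the same values as for `132` (`signSum_involutions_av132`), whence (§4) the
printed `EI_n(321)` through `2·EI = I + δ`.

## Contents (theorems only; net debt 0)

* §1 `sign_lastFixedSum`, `sign_of_fixedPointFree_involution`; `sum_sign_eq_card_even_sub_card_odd`,
  `card_eq_card_even_add_card_odd` (public versions of the `E − O` / `E + O` bookkeeping).
* §2 `signSum_fpf_involutions_av321`, ★★ `signSum_involutions_av321_eq_sum` (the signed recurrence).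
* §3 ★★★ `signSum_involutions_av321` (`δ_n = 1, 0, (−1)^{⌊n/2⌋} C_{⌊n/2⌋}` for `n = 0`, `n` even `≥ 2`, `n` odd),
  `signSum_involutions_av321_odd/even`, ★ `signSum_involutions_av321_eq_av132`.
* §4 `two_mul_card_even_odd_involutions_av321`, ★ `card_even_involutions_av321_eq_card_odd_even` («`EI_n = ½ I_n`, `n`
  even»), `two_mul_card_even_involutions_av321_odd`, ★ `card_even_involutions_av321_one_mod_four`
  (`EI_{4j+1}(321) = binom(4j, 2j)`), ★ `card_even_involutions_av321_three_mod_four` (`EI_{4j+3}(321) = binom(4j+2, 2j+2)`).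
-/

namespace Literature.Combinatorics.Enumerative

namespace PermContainsPattern

open Finset Equiv

variable {N n a b : ℕ}

/-! ### §1 Signs -/

/-- `sign((τ ⊕ 1) ⊕ μ) = sign τ · sign μ`. [cite: SimionSchmidt1985, Proposition 1 (proof) and Proposition 5 (held text p0003, p0007)] -/
theorem sign_lastFixedSum (τ : Perm (Fin a)) (μ : Perm (Fin b)) :
    Perm.sign (finSumFinEquiv.symm.trans (((finSumFinEquiv.symm.trans ((τ.sumCongr (1 : Perm (Fin 1))).trans
        finSumFinEquiv)).sumCongr μ).trans finSumFinEquiv)) = Perm.sign τ * Perm.sign μ := by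
  rw [sign_directSum, sign_directSum, Perm.sign_one, mul_one]

/-- A fixed-point-free involution of `[b]` is a product of `b/2` disjoint transpositions: its sign is `(−1)^{b/2}`.
[cite: SimionSchmidt1985, proof of Proposition 5 («sign(u) = (−1)^b», held text p0008 = p. 390)] -/
theorem sign_of_fixedPointFree_involution (μ : Perm (Fin b)) (hμ : μ * μ = 1) (hfp : ∀ i, μ i ≠ i) :
    ((Perm.sign μ : ℤˣ) : ℤ) = (-1) ^ (b / 2) := by
  rw [sign_of_mul_self_eq_one μ hμ]
  have hs : μ.support = univ := eq_univ_of_forall fun i => Perm.mem_support.2 (hfp i)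
  rw [hs, card_univ, Fintype.card_fin]

/-- `Σ_{σ ∈ S} sign σ = #{even σ ∈ S} − #{odd σ ∈ S}`. [cite: SimionSchmidt1985, §2 («E_n(R)», «O_n(R)»; held text p0002–p0003)] -/
theorem sum_sign_eq_card_even_sub_card_odd (S : Finset (Perm (Fin n))) :
    ∑ v ∈ S, ((Perm.sign v : ℤˣ) : ℤ) =
      ((S.filter fun v => Perm.sign v = 1).card : ℤ) - ((S.filter fun v => Perm.sign v = -1).card : ℤ) := by
  rw [← Finset.sum_filter_add_sum_filter_not S (fun v => Perm.sign v = 1)]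
  have hneg : S.filter (fun v => ¬ Perm.sign v = 1) = S.filter (fun v => Perm.sign v = -1) :=
    Finset.filter_congr fun v _ => ⟨fun h => (Int.units_eq_one_or (Perm.sign v)).resolve_left h,
      fun h h' => absurd (h'.symm.trans h) (by decide)⟩
  have h1 : ∑ v ∈ S.filter (fun v => Perm.sign v = 1), ((Perm.sign v : ℤˣ) : ℤ) =
      ((S.filter fun v => Perm.sign v = 1).card : ℤ) := by
    rw [Finset.card_eq_sum_ones, Nat.cast_sum]
    refine Finset.sum_congr rfl fun v hv => ?_
    rw [(Finset.mem_filter.mp hv).2, Units.val_one, Nat.cast_one]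
  have h2 : ∑ v ∈ S.filter (fun v => ¬ Perm.sign v = 1), ((Perm.sign v : ℤˣ) : ℤ) =
      -((S.filter fun v => Perm.sign v = -1).card : ℤ) := by
    rw [hneg, Finset.card_eq_sum_ones, Nat.cast_sum, ← Finset.sum_neg_distrib]
    refine Finset.sum_congr rfl fun v hv => ?_
    rw [(Finset.mem_filter.mp hv).2, Units.val_neg, Units.val_one, Nat.cast_one]
  rw [h1, h2, sub_eq_add_neg]

/-- `#S = #{even σ ∈ S} + #{odd σ ∈ S}`. [cite: SimionSchmidt1985, §2 («E_n(R)», «O_n(R)»; held text p0002–p0003)] -/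
theorem card_eq_card_even_add_card_odd (S : Finset (Perm (Fin n))) :
    S.card = (S.filter fun v => Perm.sign v = 1).card + (S.filter fun v => Perm.sign v = -1).card := by
  rw [← Finset.card_filter_add_card_filter_not (fun v => Perm.sign v = 1)]
  congr 1
  exact congrArg Finset.card (Finset.filter_congr fun v _ =>
    ⟨fun h => (Int.units_eq_one_or (Perm.sign v)).resolve_left h, fun h h' => absurd (h'.symm.trans h) (by decide)⟩)

/-- Splitting a sum over `range (2m+1)` into even and odd indices. [folklore] -/
private theorem sum_range_two_mul_add_one' (g : ℕ → ℤ) (m : ℕ) :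
    ∑ a ∈ range (2 * m + 1), g a = ∑ i ∈ range (m + 1), g (2 * i) + ∑ i ∈ range m, g (2 * i + 1) := by
  induction m with
  | zero => simp
  | succ m ih =>
    rw [show 2 * (m + 1) + 1 = 2 * m + 1 + 1 + 1 by ring, sum_range_succ, sum_range_succ, ih,
      sum_range_succ (fun i => g (2 * i)) (m + 1), sum_range_succ (fun i => g (2 * i + 1)) m,
      show 2 * m + 1 + 1 = 2 * (m + 1) by ring]
    ring

/-- Splitting a sum over `range (2m+2)` into even and odd indices. [folklore] -/
private theorem sum_range_two_mul_add_two' (g : ℕ → ℤ) (m : ℕ) :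
    ∑ a ∈ range (2 * m + 2), g a = ∑ i ∈ range (m + 1), g (2 * i) + ∑ i ∈ range (m + 1), g (2 * i + 1) := by
  rw [sum_range_succ, sum_range_two_mul_add_one', sum_range_succ (fun i => g (2 * i + 1)) m]
  ring

/-- The arithmetic of the odd step: with `δ_a = [a = 0] + [a odd] (−1)^{⌊a/2⌋} C_{⌊a/2⌋}` for `a ≤ 2m` and
`J_b = [b even] C_{b/2}`, `(−1)^m J_{2m+1} + Σ_{a ≤ 2m} δ_a (−1)^{(2m−a)/2} J_{2m−a} = (−1)^m C_m` (only `a = 0`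
contributes). [cite: SimionSchmidt1985, Proposition 5 (held text p0007–p0008)] -/
private theorem signed_step_odd (m : ℕ) :
    (-1 : ℤ) ^ ((2 * m + 1) / 2) * ((if (2 * m + 1) % 2 = 0 then catalan ((2 * m + 1) / 2) else 0 : ℕ) : ℤ) +
      ∑ a ∈ range (2 * m + 1), (if a = 0 then (1 : ℤ) else if Even a then 0 else (-1) ^ (a / 2) * (catalan (a / 2) : ℤ)) *
        ((-1) ^ ((2 * m + 1 - 1 - a) / 2) * ((if (2 * m + 1 - 1 - a) % 2 = 0 then catalan ((2 * m + 1 - 1 - a) / 2)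
          else 0 : ℕ) : ℤ)) = (-1) ^ m * catalan m := by
  rw [if_neg (show ¬ ((2 * m + 1) % 2 = 0) by omega), Nat.cast_zero, mul_zero, zero_add, sum_range_two_mul_add_one',
    Finset.sum_range_succ' (fun i => (if 2 * i = 0 then (1 : ℤ) else if Even (2 * i) then 0 else
      (-1) ^ (2 * i / 2) * (catalan (2 * i / 2) : ℤ)) * ((-1) ^ ((2 * m + 1 - 1 - 2 * i) / 2) *
        ((if (2 * m + 1 - 1 - 2 * i) % 2 = 0 then catalan ((2 * m + 1 - 1 - 2 * i) / 2) else 0 : ℕ) : ℤ)))]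
  have h1 : ∑ i ∈ range m, (if 2 * (i + 1) = 0 then (1 : ℤ) else if Even (2 * (i + 1)) then 0 else
      (-1) ^ (2 * (i + 1) / 2) * (catalan (2 * (i + 1) / 2) : ℤ)) * ((-1) ^ ((2 * m + 1 - 1 - 2 * (i + 1)) / 2) *
        ((if (2 * m + 1 - 1 - 2 * (i + 1)) % 2 = 0 then catalan ((2 * m + 1 - 1 - 2 * (i + 1)) / 2) else 0 : ℕ) :
          ℤ)) = 0 :=
    sum_eq_zero fun i _ => by
      rw [if_neg (show ¬ (2 * (i + 1) = 0) by omega), if_pos (show Even (2 * (i + 1)) from ⟨i + 1, by ring⟩),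
        zero_mul]
  have h2 : ∑ i ∈ range m, (if 2 * i + 1 = 0 then (1 : ℤ) else if Even (2 * i + 1) then 0 else
      (-1) ^ ((2 * i + 1) / 2) * (catalan ((2 * i + 1) / 2) : ℤ)) * ((-1) ^ ((2 * m + 1 - 1 - (2 * i + 1)) / 2) *
        ((if (2 * m + 1 - 1 - (2 * i + 1)) % 2 = 0 then catalan ((2 * m + 1 - 1 - (2 * i + 1)) / 2) else 0 : ℕ) :
          ℤ)) = 0 :=
    sum_eq_zero fun i hi => by
      rw [mem_range] at hi
      rw [if_neg (show ¬ ((2 * m + 1 - 1 - (2 * i + 1)) % 2 = 0) by omega), Nat.cast_zero, mul_zero, mul_zero]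
  rw [h1, h2, zero_add, add_zero, if_pos (show 2 * 0 = 0 by rfl), one_mul,
    show 2 * m + 1 - 1 - 2 * 0 = 2 * m by omega, if_pos (show 2 * m % 2 = 0 by omega),
    show 2 * m / 2 = m by omega]

/-- The arithmetic of the even step: `(−1)^{m+1} C_{m+1} + Σ_{a ≤ 2m+1} δ_a (−1)^{(2m+1−a)/2} J_{2m+1−a} = 0` (the
terms `a = 2i + 1` give `(−1)^m Σ_i C_i C_{m−i} = (−1)^m C_{m+1}` by Segner's recursion).
[cite: SimionSchmidt1985, Proposition 5 (held text p0007–p0008)] -/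
private theorem signed_step_even (m : ℕ) :
    (-1 : ℤ) ^ ((2 * m + 2) / 2) * ((if (2 * m + 2) % 2 = 0 then catalan ((2 * m + 2) / 2) else 0 : ℕ) : ℤ) +
      ∑ a ∈ range (2 * m + 2), (if a = 0 then (1 : ℤ) else if Even a then 0 else (-1) ^ (a / 2) * (catalan (a / 2) : ℤ)) *
        ((-1) ^ ((2 * m + 2 - 1 - a) / 2) * ((if (2 * m + 2 - 1 - a) % 2 = 0 then catalan ((2 * m + 2 - 1 - a) / 2)
          else 0 : ℕ) : ℤ)) = 0 := by
  rw [if_pos (show (2 * m + 2) % 2 = 0 by omega), show (2 * m + 2) / 2 = m + 1 by omega, sum_range_two_mul_add_two']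
  have h1 : ∑ i ∈ range (m + 1), (if 2 * i = 0 then (1 : ℤ) else if Even (2 * i) then 0 else
      (-1) ^ (2 * i / 2) * (catalan (2 * i / 2) : ℤ)) * ((-1) ^ ((2 * m + 2 - 1 - 2 * i) / 2) *
        ((if (2 * m + 2 - 1 - 2 * i) % 2 = 0 then catalan ((2 * m + 2 - 1 - 2 * i) / 2) else 0 : ℕ) : ℤ)) = 0 :=
    sum_eq_zero fun i hi => by
      rw [mem_range] at hi
      rw [if_neg (show ¬ ((2 * m + 2 - 1 - 2 * i) % 2 = 0) by omega), Nat.cast_zero, mul_zero, mul_zero]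
  have h2 : ∑ i ∈ range (m + 1), (if 2 * i + 1 = 0 then (1 : ℤ) else if Even (2 * i + 1) then 0 else
      (-1) ^ ((2 * i + 1) / 2) * (catalan ((2 * i + 1) / 2) : ℤ)) * ((-1) ^ ((2 * m + 2 - 1 - (2 * i + 1)) / 2) *
        ((if (2 * m + 2 - 1 - (2 * i + 1)) % 2 = 0 then catalan ((2 * m + 2 - 1 - (2 * i + 1)) / 2) else 0 : ℕ) :
          ℤ)) = (-1) ^ m * ∑ i ∈ range (m + 1), (catalan i * catalan (m - i) : ℤ) := by
    rw [Finset.mul_sum]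
    refine sum_congr rfl fun i hi => ?_
    rw [mem_range] at hi
    rw [if_neg (show ¬ (2 * i + 1 = 0) by omega), if_neg (show ¬ Even (2 * i + 1) from
        Nat.not_even_iff_odd.mpr ⟨i, rfl⟩), show (2 * i + 1) / 2 = i by omega,
      if_pos (show (2 * m + 2 - 1 - (2 * i + 1)) % 2 = 0 by omega),
      show (2 * m + 2 - 1 - (2 * i + 1)) / 2 = m - i by omega]
    have hp : ((-1 : ℤ) ^ i) * (-1) ^ (m - i) = (-1) ^ m := by rw [← pow_add, Nat.add_sub_cancel' (by omega)]
    linear_combination (catalan i : ℤ) * (catalan (m - i) : ℤ) * hp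
  have hC : ∑ i ∈ range (m + 1), (catalan i * catalan (m - i) : ℤ) = catalan (m + 1) := by
    rw [catalan_succ', Nat.sum_antidiagonal_eq_sum_range_succ_mk]
    push_cast
    rfl
  rw [h1, h2, zero_add, hC, pow_succ]
  ring

variable [∀ j, DecidablePred fun u : Perm (Fin j) => ¬ PermContainsPattern u ![3, 2, 1]]

/-! ### §2 The signed recurrence at the last fixed point -/

/-- The signed count of the fixed-point-free `321`-avoiding involutions of `[b]` is `(−1)^{b/2} J_b`.
[cite: SimionSchmidt1985, Proposition 5 (held text p0007–p0008)] -/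
theorem signSum_fpf_involutions_av321 (b : ℕ) :
    ∑ μ ∈ (univ.filter fun μ : Perm (Fin b) => (μ * μ = 1 ∧ ¬ PermContainsPattern μ ![3, 2, 1]) ∧ ∀ i, μ i ≠ i),
        ((Perm.sign μ : ℤˣ) : ℤ) =
      (-1) ^ (b / 2) * Nat.card {μ : Perm (Fin b) // (μ * μ = 1 ∧ ¬ PermContainsPattern μ ![3, 2, 1]) ∧ ∀ i, μ i ≠ i} := by
  rw [Finset.sum_congr rfl fun μ hμ => sign_of_fixedPointFree_involution μ (mem_filter.1 hμ).2.1.1 (mem_filter.1 hμ).2.2,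
    sum_const, nsmul_eq_mul, mul_comm, Nat.card_eq_fintype_card, Fintype.card_subtype]

/-- ★★ **The signed recurrence**: with `δ_N = Σ_{u ∈ I_N(321)} sign u` and `J_b` the number of fixed-point-free
`321`-avoiding involutions of `[b]`, `δ_N = (−1)^{N/2} J_N + Σ_{a<N} δ_a · (−1)^{(N−1−a)/2} J_{N−1−a}` — the
decomposition `(τ ⊕ 1) ⊕ μ` at the last fixed point (`lastFixedSum_bijective`) is sign-multiplicative.
[cite: SimionSchmidt1985, Proposition 5 (held text p0007–p0008 = pp. 389–390)] -/
theorem signSum_involutions_av321_eq_sum (N : ℕ) :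
    ∑ σ ∈ (univ.filter fun σ : Perm (Fin N) => σ * σ = 1 ∧ ¬ PermContainsPattern σ ![3, 2, 1]),
        ((Perm.sign σ : ℤˣ) : ℤ) =
      (-1) ^ (N / 2) * Nat.card {μ : Perm (Fin N) // (μ * μ = 1 ∧ ¬ PermContainsPattern μ ![3, 2, 1]) ∧ ∀ i, μ i ≠ i} +
        ∑ a ∈ range N, (∑ τ ∈ (univ.filter fun τ : Perm (Fin a) => τ * τ = 1 ∧ ¬ PermContainsPattern τ ![3, 2, 1]),
            ((Perm.sign τ : ℤˣ) : ℤ)) *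
          ((-1) ^ ((N - 1 - a) / 2) * Nat.card {μ : Perm (Fin (N - 1 - a)) //
            (μ * μ = 1 ∧ ¬ PermContainsPattern μ ![3, 2, 1]) ∧ ∀ i, μ i ≠ i}) := by
  -- sort by the statistic «last fixed point + 1, or 0» with values in `Fin (N + 1)`
  rw [← Finset.sum_fiberwise (univ.filter fun σ : Perm (Fin N) => σ * σ = 1 ∧ ¬ PermContainsPattern σ ![3, 2, 1])
    (fun σ => (⟨(univ.filter fun g : Fin N => σ g = g).sup (fun g => (g : ℕ) + 1),
      Nat.lt_succ_of_le (Finset.sup_le fun g _ => g.2)⟩ : Fin (N + 1)))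
    (fun σ => ((Perm.sign σ : ℤˣ) : ℤ)), Fin.sum_univ_succ]
  congr 1
  · -- no fixed point
    rw [← signSum_fpf_involutions_av321]
    refine Finset.sum_congr (Finset.ext fun σ => ?_) fun _ _ => rfl
    simp only [Finset.mem_filter, mem_univ, true_and]
    refine and_congr_right fun _ => ?_
    rw [Fin.ext_iff, Fin.val_zero]
    exact lastFixedStat_eq_zero_iff σ
  · rw [← Fin.sum_univ_eq_sum_range (fun a => (∑ τ ∈ (univ.filter fun τ : Perm (Fin a) =>
      τ * τ = 1 ∧ ¬ PermContainsPattern τ ![3, 2, 1]), ((Perm.sign τ : ℤˣ) : ℤ)) *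
        ((-1) ^ ((N - 1 - a) / 2) * Nat.card {μ : Perm (Fin (N - 1 - a)) //
          (μ * μ = 1 ∧ ¬ PermContainsPattern μ ![3, 2, 1]) ∧ ∀ i, μ i ≠ i})) N]
    refine Finset.sum_congr rfl fun a _ => ?_
    obtain ⟨a, ha⟩ := a
    obtain ⟨b, rfl⟩ : ∃ b, N = a + 1 + b := ⟨N - 1 - a, by omega⟩
    rw [Fin.val_mk, show a + 1 + b - 1 - a = b by omega, ← signSum_fpf_involutions_av321]
    -- the fibre over `a + 1` is the set of involutions whose last fixed point is `a`
    have hfib : ((univ.filter fun σ : Perm (Fin (a + 1 + b)) => σ * σ = 1 ∧ ¬ PermContainsPattern σ ![3, 2, 1]).filter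
        fun σ => (⟨(univ.filter fun g : Fin (a + 1 + b) => σ g = g).sup (fun g => (g : ℕ) + 1),
          Nat.lt_succ_of_le (Finset.sup_le fun g _ => g.2)⟩ : Fin (a + 1 + b + 1)) = (⟨a, ha⟩ : Fin (a + 1 + b)).succ) =
        univ.filter fun σ : Perm (Fin (a + 1 + b)) => (σ * σ = 1 ∧ ¬ PermContainsPattern σ ![3, 2, 1]) ∧
          (∃ g, σ g = g ∧ (g : ℕ) = a) ∧ ∀ g, σ g = g → (g : ℕ) ≤ a := by
      ext σ
      simp only [Finset.mem_filter, mem_univ, true_and]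
      refine and_congr_right fun _ => ?_
      rw [Fin.ext_iff, Fin.val_succ]
      exact lastFixedStat_eq_succ_iff σ a
    rw [hfib, Finset.sum_subtype (p := fun σ : Perm (Fin (a + 1 + b)) => (σ * σ = 1 ∧
        ¬ PermContainsPattern σ ![3, 2, 1]) ∧ (∃ g, σ g = g ∧ (g : ℕ) = a) ∧ ∀ g, σ g = g → (g : ℕ) ≤ a) _
        (fun σ => mem_filter.trans (and_iff_right (mem_univ _))),
      Finset.sum_subtype (p := fun τ : Perm (Fin a) => τ * τ = 1 ∧ ¬ PermContainsPattern τ ![3, 2, 1]) _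
        (fun τ => mem_filter.trans (and_iff_right (mem_univ _))),
      Finset.sum_subtype (p := fun μ : Perm (Fin b) => (μ * μ = 1 ∧ ¬ PermContainsPattern μ ![3, 2, 1]) ∧
        ∀ i, μ i ≠ i) _ (fun μ => mem_filter.trans (and_iff_right (mem_univ _))),
      Finset.sum_mul_sum, ← Fintype.sum_prod_type']
    exact (Fintype.sum_bijective _ (lastFixedSum_bijective a b)
      (fun p => ((Perm.sign p.1.1 : ℤˣ) : ℤ) * ((Perm.sign p.2.1 : ℤˣ) : ℤ))
      (fun x => ((Perm.sign x.1 : ℤˣ) : ℤ)) (fun p => by rw [sign_lastFixedSum, Units.val_mul])).symm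

/-! ### §3 The closed form of `δ_n = EI_n(321) − OI_n(321)` -/

/-- ★★★ **PROPOSITION 5 (Simion–Schmidt 1985), `p = 321`, signed half**: `δ_n = EI_n(321) − OI_n(321)` equals `1`
for `n = 0`, `0` for even `n ≥ 2` («`EI_n = ½ I_n` if `n` is even») and `(−1)^{(n−1)/2} C_{(n−1)/2}` for odd `n` — the
same values as for `p = 132` (`InvolutionsAvoiding132Signs.signSum_involutions_av132`).
[cite: SimionSchmidt1985, Proposition 5 (held text p0007–p0008 = pp. 389–390)] -/
theorem signSum_involutions_av321 (n : ℕ) :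
    ∑ u ∈ (univ.filter fun u : Perm (Fin n) => u * u = 1 ∧ ¬ PermContainsPattern u ![3, 2, 1]),
        ((Perm.sign u : ℤˣ) : ℤ) =
      if n = 0 then (1 : ℤ) else if Even n then 0 else (-1) ^ (n / 2) * (catalan (n / 2) : ℤ) := by
  induction n using Nat.strong_induction_on with
  | _ n ih =>
  rw [signSum_involutions_av321_eq_sum, card_fpf_involutions_av321_eq_ite]
  have hs : ∑ a ∈ range n, (∑ τ ∈ (univ.filter fun τ : Perm (Fin a) => τ * τ = 1 ∧
      ¬ PermContainsPattern τ ![3, 2, 1]), ((Perm.sign τ : ℤˣ) : ℤ)) * ((-1) ^ ((n - 1 - a) / 2) *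
        Nat.card {μ : Perm (Fin (n - 1 - a)) // (μ * μ = 1 ∧ ¬ PermContainsPattern μ ![3, 2, 1]) ∧ ∀ i, μ i ≠ i}) =
      ∑ a ∈ range n, (if a = 0 then (1 : ℤ) else if Even a then 0 else (-1) ^ (a / 2) * (catalan (a / 2) : ℤ)) *
        ((-1) ^ ((n - 1 - a) / 2) * ((if (n - 1 - a) % 2 = 0 then catalan ((n - 1 - a) / 2) else 0 : ℕ) : ℤ)) :=
    sum_congr rfl fun a ha => by rw [ih a (mem_range.1 ha), card_fpf_involutions_av321_eq_ite]
  rw [hs]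
  rcases n with _ | n
  · simp
  rw [if_neg (Nat.succ_ne_zero n)]
  obtain ⟨m, rfl | rfl⟩ := Nat.even_or_odd' n
  · -- `n + 1 = 2m + 1`
    rw [signed_step_odd, if_neg (show ¬ Even (2 * m + 1) from Nat.not_even_iff_odd.mpr ⟨m, rfl⟩),
      show (2 * m + 1) / 2 = m by omega]
  · -- `n + 1 = 2m + 2`
    rw [show 2 * m + 1 + 1 = 2 * m + 2 from rfl, signed_step_even, if_pos (show Even (2 * m + 2) from ⟨m + 1, by ring⟩)]

/-- `δ_{2m+1}(321) = (−1)^m C_m`. [cite: SimionSchmidt1985, Proposition 5 (held text p0007 = p. 389)] -/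
theorem signSum_involutions_av321_odd (m : ℕ) :
    ∑ u ∈ (univ.filter fun u : Perm (Fin (2 * m + 1)) => u * u = 1 ∧ ¬ PermContainsPattern u ![3, 2, 1]),
        ((Perm.sign u : ℤˣ) : ℤ) = (-1) ^ m * catalan m := by
  rw [signSum_involutions_av321, if_neg (Nat.succ_ne_zero _), if_neg (Nat.not_even_iff_odd.mpr ⟨m, rfl⟩),
    show (2 * m + 1) / 2 = m by omega]

/-- `δ_{2m+2}(321) = 0`. [cite: SimionSchmidt1985, Proposition 5 (held text p0007 = p. 389)] -/
theorem signSum_involutions_av321_even (m : ℕ) :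
    ∑ u ∈ (univ.filter fun u : Perm (Fin (2 * m + 2)) => u * u = 1 ∧ ¬ PermContainsPattern u ![3, 2, 1]),
        ((Perm.sign u : ℤˣ) : ℤ) = 0 := by
  rw [signSum_involutions_av321, if_neg (Nat.succ_ne_zero _), if_pos ⟨m + 1, by ring⟩]

/-- ★ **`EI_n(321) − OI_n(321) = EI_n(132) − OI_n(132)`** (Proposition 5 states one signed formula for all of `132`,
`213`, `321`). [cite: SimionSchmidt1985, Proposition 5 (held text p0007 = p. 389)] -/
theorem signSum_involutions_av321_eq_av132 [∀ j, DecidablePred fun u : Perm (Fin j) => ¬ PermContainsPattern u ![1, 3, 2]]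
    (n : ℕ) :
    ∑ u ∈ (univ.filter fun u : Perm (Fin n) => u * u = 1 ∧ ¬ PermContainsPattern u ![3, 2, 1]),
        ((Perm.sign u : ℤˣ) : ℤ) =
      ∑ u ∈ (univ.filter fun u : Perm (Fin n) => u * u = 1 ∧ ¬ PermContainsPattern u ![1, 3, 2]),
        ((Perm.sign u : ℤˣ) : ℤ) := by
  rw [signSum_involutions_av321, signSum_involutions_av132]

/-! ### §4 The even `321`-avoiding involutions `EI_n(321)` -/

/-- `2 · EI_n = I_n + δ_n` and `2 · OI_n = I_n − δ_n` for the even / odd `321`-avoiding involutions.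
[cite: SimionSchmidt1985, Proposition 5 (held text p0007 = p. 389)] -/
theorem two_mul_card_even_odd_involutions_av321 (n : ℕ) :
    2 * (Nat.card {u : Perm (Fin n) // (u * u = 1 ∧ ¬ PermContainsPattern u ![3, 2, 1]) ∧ Perm.sign u = 1} : ℤ) =
        n.choose (n / 2) + ∑ u ∈ (univ.filter fun u : Perm (Fin n) => u * u = 1 ∧ ¬ PermContainsPattern u ![3, 2, 1]),
          ((Perm.sign u : ℤˣ) : ℤ) ∧
      2 * (Nat.card {u : Perm (Fin n) // (u * u = 1 ∧ ¬ PermContainsPattern u ![3, 2, 1]) ∧ Perm.sign u = -1} : ℤ) =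
        n.choose (n / 2) - ∑ u ∈ (univ.filter fun u : Perm (Fin n) => u * u = 1 ∧ ¬ PermContainsPattern u ![3, 2, 1]),
          ((Perm.sign u : ℤˣ) : ℤ) := by
  have hE : Nat.card {u : Perm (Fin n) // (u * u = 1 ∧ ¬ PermContainsPattern u ![3, 2, 1]) ∧ Perm.sign u = 1} =
      ((univ.filter fun u : Perm (Fin n) => u * u = 1 ∧ ¬ PermContainsPattern u ![3, 2, 1]).filter
        fun v => Perm.sign v = 1).card := by
    rw [Nat.card_eq_fintype_card, Fintype.card_subtype, Finset.filter_filter]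
  have hO : Nat.card {u : Perm (Fin n) // (u * u = 1 ∧ ¬ PermContainsPattern u ![3, 2, 1]) ∧ Perm.sign u = -1} =
      ((univ.filter fun u : Perm (Fin n) => u * u = 1 ∧ ¬ PermContainsPattern u ![3, 2, 1]).filter
        fun v => Perm.sign v = -1).card := by
    rw [Nat.card_eq_fintype_card, Fintype.card_subtype, Finset.filter_filter]
  have hA : n.choose (n / 2) =
      (univ.filter fun u : Perm (Fin n) => u * u = 1 ∧ ¬ PermContainsPattern u ![3, 2, 1]).card := by
    rw [← card_involutions_av321 n, Nat.card_eq_fintype_card, Fintype.card_subtype]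
  rw [hE, hO, hA, sum_sign_eq_card_even_sub_card_odd,
    card_eq_card_even_add_card_odd (univ.filter fun u : Perm (Fin n) => u * u = 1 ∧ ¬ PermContainsPattern u ![3, 2, 1])]
  push_cast
  constructor <;> ring

/-- ★ PROPOSITION 5, even length: «`EI_n(p) = ½ I_n(p)` if `n` is even» (`n ≥ 2`): `EI_{2m+2}(321) = OI_{2m+2}(321)`.
[cite: SimionSchmidt1985, Proposition 5 (held text p0007 = p. 389)] -/
theorem card_even_involutions_av321_eq_card_odd_even (m : ℕ) :
    Nat.card {u : Perm (Fin (2 * m + 2)) // (u * u = 1 ∧ ¬ PermContainsPattern u ![3, 2, 1]) ∧ Perm.sign u = 1} =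
      Nat.card {u : Perm (Fin (2 * m + 2)) // (u * u = 1 ∧ ¬ PermContainsPattern u ![3, 2, 1]) ∧ Perm.sign u = -1} := by
  have h := two_mul_card_even_odd_involutions_av321 (2 * m + 2)
  rw [signSum_involutions_av321_even, add_zero, sub_zero] at h
  have h' := h.1.trans h.2.symm
  exact_mod_cast (mul_right_injective₀ (two_ne_zero) h' : _)

/-- ★ PROPOSITION 5, odd length: `2 · EI_{2m+1}(321) = binom(2m+1, m) + (−1)^m C_m` and
`EI_{2m+1}(321) − OI_{2m+1}(321) = (−1)^m C_m`. [cite: SimionSchmidt1985, Proposition 5 (held text p0007 = p. 389)] -/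
theorem two_mul_card_even_involutions_av321_odd (m : ℕ) :
    2 * (Nat.card {u : Perm (Fin (2 * m + 1)) // (u * u = 1 ∧ ¬ PermContainsPattern u ![3, 2, 1]) ∧
        Perm.sign u = 1} : ℤ) = (2 * m + 1).choose m + (-1) ^ m * catalan m ∧
      (Nat.card {u : Perm (Fin (2 * m + 1)) // (u * u = 1 ∧ ¬ PermContainsPattern u ![3, 2, 1]) ∧
        Perm.sign u = 1} : ℤ) -
        Nat.card {u : Perm (Fin (2 * m + 1)) // (u * u = 1 ∧ ¬ PermContainsPattern u ![3, 2, 1]) ∧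
          Perm.sign u = -1} = (-1) ^ m * catalan m := by
  have h := two_mul_card_even_odd_involutions_av321 (2 * m + 1)
  rw [signSum_involutions_av321_odd, show (2 * m + 1) / 2 = m by omega] at h
  obtain ⟨h1, h2⟩ := h
  exact ⟨h1, by linarith⟩

/-- ★ «`EI_n(321) = binom(n−1, (n−1)/2)` if `n ≡ 1 (mod 4)`»: `EI_{4j+1}(321) = binom(4j, 2j)`.
[cite: SimionSchmidt1985, Proposition 5 (held text p0007 = p. 389)] -/
theorem card_even_involutions_av321_one_mod_four (j : ℕ) :
    Nat.card {u : Perm (Fin (2 * (2 * j) + 1)) // (u * u = 1 ∧ ¬ PermContainsPattern u ![3, 2, 1]) ∧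
      Perm.sign u = 1} = (4 * j).choose (2 * j) := by
  have h := (two_mul_card_even_involutions_av321_odd (2 * j)).1
  have hc := catalan_eq_centralBinom_sub_choose (2 * j)
  rw [show 2 * (2 * j) = 4 * j by ring] at hc
  rw [Even.neg_one_pow ⟨j, two_mul j⟩, one_mul, hc] at h
  have h3 : ((2 * (2 * j) + 1).choose (2 * j) : ℤ) = (4 * j).choose (2 * j) + (4 * j).choose (2 * j + 1) := by
    rw [← Nat.choose_symm_half (2 * j), show 2 * (2 * j) = 4 * j by ring, Nat.choose_succ_succ']
    push_cast
    ring
  have : (Nat.card {u : Perm (Fin (2 * (2 * j) + 1)) // (u * u = 1 ∧ ¬ PermContainsPattern u ![3, 2, 1]) ∧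
      Perm.sign u = 1} : ℤ) = (4 * j).choose (2 * j) := by linarith
  exact_mod_cast this

/-- ★ «`EI_n(321) = binom(n−1, (n+1)/2)` if `n ≡ 3 (mod 4)`»: `EI_{4j+3}(321) = binom(4j+2, 2j+2)`.
[cite: SimionSchmidt1985, Proposition 5 (held text p0007 = p. 389)] -/
theorem card_even_involutions_av321_three_mod_four (j : ℕ) :
    Nat.card {u : Perm (Fin (2 * (2 * j + 1) + 1)) // (u * u = 1 ∧ ¬ PermContainsPattern u ![3, 2, 1]) ∧
      Perm.sign u = 1} = (4 * j + 2).choose (2 * j + 2) := by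
  have h := (two_mul_card_even_involutions_av321_odd (2 * j + 1)).1
  have hc := catalan_eq_centralBinom_sub_choose (2 * j + 1)
  rw [show 2 * (2 * j + 1) = 4 * j + 2 by ring, show 2 * j + 1 + 1 = 2 * j + 2 by ring] at hc
  rw [Odd.neg_one_pow ⟨j, rfl⟩, neg_one_mul, hc] at h
  have h3 : ((2 * (2 * j + 1) + 1).choose (2 * j + 1) : ℤ) =
      (4 * j + 2).choose (2 * j + 1) + (4 * j + 2).choose (2 * j + 2) := by
    rw [show 2 * (2 * j + 1) = 4 * j + 2 by ring, Nat.choose_succ_succ' (4 * j + 2) (2 * j),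
      Nat.choose_symm_of_eq_add (show 4 * j + 2 = 2 * j + (2 * j + 2) by ring)]
    push_cast
    ring
  have : (Nat.card {u : Perm (Fin (2 * (2 * j + 1) + 1)) // (u * u = 1 ∧ ¬ PermContainsPattern u ![3, 2, 1]) ∧
      Perm.sign u = 1} : ℤ) = (4 * j + 2).choose (2 * j + 2) := by linarith
  exact_mod_cast this

end PermContainsPattern

end Literature.Combinatorics.Enumerative
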